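import Summits.ValiantsHypothesis.ValiantsHypothesis.Theorems.KPlusLogSqLawOctaveGlue
import Summits.ValiantsHypothesis.ValiantsHypothesis.Theorems.KPlusLogSqLawOctaveWitness

/-!
# Route «KPlusLogSqLaw», octave line — GLUE COHERENCE: the Theses-free glue twins ARE the landed octave objects

HONEST FRAMING.  Prover seat val-width-19561-oc1 (`--supports stmt-ValiantsHypothesis-19561`).  Kernel bookkeeping only: the
Theses-free module `KPlusLogSqLawOctaveGlue{Witness}` (namespace `…OctaveGlue`, importable by the route file) re-declares `octave` /
`octaveCount` / `OctaveRootLawAt` with the same bodies as the landed `…Octave` ones and states its deciding theorem with binders in the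
verbatim shapes of `Theses.KPlusLogSqLaw.TropicalB` and of `Octave.OctaveWeakLifting`; this file records that all of these agree
DEFINITIONALLY (`rfl` / `Iff.rfl`), so `OctaveGlue.valiant_of_tropicalB_of_octaveWeakLifting hT hΩ` type-checks with
`hT : TropicalB`, `hΩ : Octave.OctaveWeakLifting` (the `example` at the end).  Nothing is proved about TropicalB / Ω-W / B; VP ≠ VNP not moved.
-/

set_option linter.dupNamespace false
set_option autoImplicit false

namespace Summit.ValiantsHypothesis.ValiantsHypothesis.Theorems.KPlusLogSqLaw.OctaveGlue

open Polynomial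
open Summit.ValiantsHypothesis.ValiantsHypothesis.Theses.KPlusLogSqLaw (TropicalB WeakLifting)

/-- the glue's `octave` is the landed `Octave.octave`. -/
theorem octave_eq : @Summit.ValiantsHypothesis.ValiantsHypothesis.Theorems.KPlusLogSqLaw.OctaveGlue.octave = @Summit.ValiantsHypothesis.ValiantsHypothesis.Theorems.KPlusLogSqLaw.Octave.octave := rfl

/-- the glue's `octaveCount` is the landed `Octave.octaveCount`. -/
theorem octaveCount_eq : @Summit.ValiantsHypothesis.ValiantsHypothesis.Theorems.KPlusLogSqLaw.OctaveGlue.octaveCount = @Summit.ValiantsHypothesis.ValiantsHypothesis.Theorems.KPlusLogSqLaw.Octave.octaveCount := rfl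

/-- the glue's octave row is the landed `Octave.OctaveRootLawAt`. -/
theorem octaveRootLawAt_iff (m K B : ℕ) : Summit.ValiantsHypothesis.ValiantsHypothesis.Theorems.KPlusLogSqLaw.OctaveGlue.OctaveRootLawAt m K B ↔ Summit.ValiantsHypothesis.ValiantsHypothesis.Theorems.KPlusLogSqLaw.Octave.OctaveRootLawAt m K B := Iff.rfl

/-- the glue's first binder shape is `TropicalB` (stmt-ValiantsHypothesis-19771) verbatim. -/
theorem tropicalB_iff_glueShape : TropicalB ↔
    (∃ C : ℕ, ∀ (m K : ℕ), ∀ (d : Fin K → ℕ) (v ε : Fin m → Fin m → Fin K → ℤ) (n : ℕ) (θ : Fin (n + 1) → ℤ)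
      (p : Fin (n + 1) → Equiv.Perm (Fin m) × (Fin m → Fin K)), (∀ i j l, (ε i j l).natAbs ≤ 1) → StrictMono θ →
      (∀ k, Summit.ValiantsHypothesis.ValiantsHypothesis.Theorems.MatrixDescartes.Negative.IsDominant d v ε (θ k) (p k)) →
      (∀ k : Fin n, Summit.ValiantsHypothesis.ValiantsHypothesis.Theorems.MatrixDescartes.Negative.termSign ε (p k.castSucc) *
        Summit.ValiantsHypothesis.ValiantsHypothesis.Theorems.MatrixDescartes.Negative.termSign ε (p k.succ) < 0) →
      n ≤ 2 ^ (C * (K + Nat.log 2 m ^ 2))) := Iff.rfl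

/-- the glue's second binder shape is the landed `Octave.OctaveWeakLifting` (the proposed route item, hypothesis of `WeakLifting` verbatim,
octave conclusion). -/
theorem octaveWeakLifting_iff_glueShape : Summit.ValiantsHypothesis.ValiantsHypothesis.Theorems.KPlusLogSqLaw.Octave.OctaveWeakLifting ↔
    (∃ C : ℕ, ∀ (m K n : ℕ), (∀ (d : Fin K → ℕ) (v ε : Fin m → Fin m → Fin K → ℤ) (n' : ℕ) (θ : Fin (n' + 1) → ℤ)
      (p : Fin (n' + 1) → Equiv.Perm (Fin m) × (Fin m → Fin K)), (∀ i j l, (ε i j l).natAbs ≤ 1) → StrictMono θ →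
      (∀ k, Summit.ValiantsHypothesis.ValiantsHypothesis.Theorems.MatrixDescartes.Negative.IsDominant d v ε (θ k) (p k)) →
      (∀ k : Fin n', Summit.ValiantsHypothesis.ValiantsHypothesis.Theorems.MatrixDescartes.Negative.termSign ε (p k.castSucc) *
        Summit.ValiantsHypothesis.ValiantsHypothesis.Theorems.MatrixDescartes.Negative.termSign ε (p k.succ) < 0) → n' ≤ n) →
      ∀ (d : Fin K → ℕ) (S : Fin K → Matrix (Fin m) (Fin m) ℝ), (∀ l, (S l).IsSymm) →
        Summit.ValiantsHypothesis.ValiantsHypothesis.Theorems.KPlusLogSqLaw.OctaveGlue.octaveCount (Matrix.det (∑ l, ((Polynomial.X : Polynomial ℝ) ^ d l) • (S l).map Polynomial.C))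
          ≤ 2 ^ (C * (K + Nat.log 2 m ^ 2)) * (n + 1)) := Iff.rfl

/-- the glue's Ω-Θ statement is the landed `Octave.OctaveThetaWitness`. -/
theorem octaveThetaWitness_iff : Summit.ValiantsHypothesis.ValiantsHypothesis.Theorems.KPlusLogSqLaw.Octave.OctaveThetaWitness ↔
    (∃ (Θ : ∀ n : ℕ, MvPolynomial (Fin n) ℝ) (d : ∀ n : ℕ, Fin n → ℕ),
      Literature.Computability.AlgebraicComplexity.IsVNPFamily (fun n => MvPolynomial.map (algebraMap ℝ ℂ) (Θ n)) ∧
      ∃ n₀ : ℕ, ∀ n : ℕ, n₀ ≤ n →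
        2 ^ (n * Nat.log 2 n) ≤ Summit.ValiantsHypothesis.ValiantsHypothesis.Theorems.KPlusLogSqLaw.OctaveGlue.octaveCount (MvPolynomial.aeval (fun i => (Polynomial.X : Polynomial ℝ) ^ d n i) (Θ n)) + 1) :=
  Iff.rfl

/-- PREVIEW of the custodian's glue: with `hT : TropicalB` and `hΩ : Octave.OctaveWeakLifting` (= the proposed item's body), the Theses-free
deciding theorem applies verbatim (δ-equal binders). -/
example (hT : TropicalB) (hΩ : Summit.ValiantsHypothesis.ValiantsHypothesis.Theorems.KPlusLogSqLaw.Octave.OctaveWeakLifting) : _root_.ValiantsHypothesis :=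
  Summit.ValiantsHypothesis.ValiantsHypothesis.Theorems.KPlusLogSqLaw.OctaveGlue.valiant_of_tropicalB_of_octaveWeakLifting hT hΩ

end Summit.ValiantsHypothesis.ValiantsHypothesis.Theorems.KPlusLogSqLaw.OctaveGlue
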